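import Summits.BirchSwinnertonDyer.BirchSwinnertonDyer.Theorems.ClassRecordThreeHalvesAtThreeLeaves
import Summits.BirchSwinnertonDyer.BirchSwinnertonDyer.Theorems.ClassRecordThreeHalvesAtThreeOfChildren
import Summits.BirchSwinnertonDyer.BirchSwinnertonDyer.Theorems.KolyvaginRoadThreeHalvesTamAtThreeLeaves
import Summits.BirchSwinnertonDyer.BirchSwinnertonDyer.Theorems.KolyvaginRoadThreeHalvesTamAtThreeOfChildren
import Summits.BirchSwinnertonDyer.Rank1Residual.X11b.FrameLambdaUnit
import HarnessLib

/-!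
# Routes `ClassRecordThree` ∕ `KolyvaginRoadThree`: the H3 children `IMCDivTwoLociAtThree` (item 19494, child of
# `HalvesAtThree` 19107) and `IMCDivTwoLociTamAtThree` (item 19506, child of `HalvesTamAtThree` 19155) — BY-NAME
# SUPPLIERS over the leaf and the registered BC3 stubs, the two routes compared, and the ∃-FRAME RECEIVING SOCKET for
# H3@3 (`Three.IMCDivAt₃` does not see the frame)

Cell `bsd-stepL` (run/shared/lean/pub/bsd-stepL/), seat `bsd-stepL-thmc-p1` (prover g5, D-0074 hands, 2026-08-26),
`--supports stmt-BirchSwinnertonDyer-19494` (helper). Companion of this seat's g4 file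
`Theorems/ClassRecordThreeValueContinuityAtThreeSuppliers.lean` (the H2 child 19493): the same by-name layer for the H3
children of the two HALVES@3 cruxes, whose BC3 skeletons (planner g24, `Cruxes/IMCDivTwoLociAtThree/…`,
`Cruxes/IMCDivTwoLociTamAtThree/…`, registered 2026-08-26T09:00Z) carry the stubs `stub_imcDiv3_ram_split` ∕
`stub_imcDiv3_unram_surj` (K2@3) and `stub_imcDiv3_ram_split_tam` ∕ `stub_imcDiv3_unram_surj` (KOLY).

## What this file records in the kernel (implications and equivalences only; H3@3 is OPEN; nothing discharged)

§1 (K2@3) `IMCDivLeafAtThree` (aside 19407) ⟹ crux 19494 and ⟹ each registered stub; crux 19494 ⟺ stub (i) ∧ stub (ii)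
   (the loci split is lossless); the leaf ⟺ the crux ∧ H3 on road (a)'s atom ((ram) ∧ non-split(3) ∧ surj) — the
   one X11b@3 ∧ surj atom the crux leaves out (`Three.IMCDivAt₃ W` binds `Surj W 3` inside, so the ¬surj corner is
   vacuous, `imcDivAt₃_of_not_surj`); `HalvesAtThree` ⟸ `ValueContinuityAtThree` ∧ stub (i) ∧ stub (ii) BY NAME through
   the closed glue 19495 (`halvesAtThreeOfChildren_holds`); conversely crux 19107 ⟹ crux 19494.
§2 (both routes) **the ∃-frame receiving socket for H3 at `p = 3`**: `Three.IMCDivAt₃ W` asks the divisibility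
   `Ch_Λ(X_ac^∅)·R₀⟦T⟧ ⊆ (L)` of EVERY BDP frame `(ι', Ω_K, Ω_p, L)`; by multr1-p1's IDEAL RIGIDITY ACROSS PERIODS
   (`R1.le_span_singleton_iff_of_isBDPLFunction`: at an odd prime, over an imaginary quadratic field, for an
   anticyclotomic `κ`, two frames of the same `(ι', 𝔭, κ, γ, f)` with non-zero periods generate the same ideal of
   `R₀⟦T⟧`) it suffices that at every X11b@3 datum and every `ι'` inducing `𝔭` SOME frame with non-zero periods has
   the divisibility (`imcDivAt₃_of_exists_frame_dvd`) — the shape in which any future `p = 3` engine (one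
   construction, its own CM periods) would deliver H3; class-wide: `classRecordThree_imcDivLeafAtThree_of_exists_frame_dvd`.
§3 (KOLY) crux 19494 ⟹ crux 19506 (the Kolyvagin road restricts locus (i) by `3 ∣ ∏ c_ℓ`); crux 19506 ⟺ its two
   registered stubs; K2@3's stub (i) ⟹ KOLY's stub (i); stub (ii) `stub_imcDiv3_unram_surj` is ONE statement on both
   routes; the KOLY leaf ⟹ crux 19506; `HalvesTamAtThree` ⟸ `ValueContinuityAtThree` ∧ the KOLY stubs by name
   (glue 19507, `halvesTamAtThreeOfChildren_holds`); and EXACTLY what 19494 adds to 19506: H3 on (ram) ∧ split(3) ∧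
   `¬ 3 ∣ ∏ c_ℓ` (`classRecordThree_imcDivTwoLociAtThree_iff_koly_and_tamagawaUnit`).

HONEST FRAMING: by-name glue; H3@3 (one inclusion of the BDP anticyclotomic main conjecture at `3 ∥ N`) is open
mathematics — no printed engine at `p = 3` (Wan 2020 ∕ Castella 2018 Thm. 4.4 ∕ Fouquet–Wan Thm. 4.41 via Hida
congruences need `p ≥ 5` or a tame datum vacuous at 3, TARGET.md §1.1 H3); nothing is discharged; no node, label or
census count moves (T7); O2 stays OPEN.

References: [Castella2018] F. Castella, Camb. J. Math. 6 (2018) = arXiv:1704.06608, §1 (1.b), Thm. 3.1, Thm. 4.4;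
[Castella2018Erratum] Thm. 1.1; [CastellaHsieh2018] Math. Ann. 370, §3.3, Def. 3.5, Prop. 3.6 (the interpolation
property characterising the frame); cell files `plan/bc3/IMCDivTwoLociAtThree_birth.lean`,
`plan/bc3/IMCDivTwoLociTamAtThree_birth.lean` (registered stubs, verbatim below).
-/

noncomputable section

open scoped Classical Topology

open Filter WeierstrassCurve NumberField IsDedekindDomain Field PowerSeries
  Literature.NumberTheory.EllipticCurves Literature.NumberTheory.EllipticCurves.ModularForms
  Literature.NumberTheory.EllipticCurves.Rank1Residual
  Literature.NumberTheory.GaloisRepresentations Literature.NumberTheory.GaloisCohomology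
  Summit.BirchSwinnertonDyer.Rank1Residual Summit.BirchSwinnertonDyer.Rank1Residual.X11b
  Summit.BirchSwinnertonDyer.Rank1Residual.X11b.AcSelmer
  Summit.BirchSwinnertonDyer.Rank1Residual.X11b.CongruenceLimit
  Summit.BirchSwinnertonDyer.Rank1Residual.X11b.Halves
  Summit.BirchSwinnertonDyer.Rank1Residual.X11b.Three
  Summit.BirchSwinnertonDyer.BirchSwinnertonDyer.Theses

namespace Summit.BirchSwinnertonDyer.BirchSwinnertonDyer.Theorems

/-! ## §1 Route `ClassRecordThree`: crux 19494 over the leaf 19407 and its registered stubs -/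

/-- **Leaf ⟹ crux**: `IMCDivLeafAtThree` (aside 19407: `Three.IMCDivAt₃ W` for every X11b@3 curve) gives
`IMCDivTwoLociAtThree` (crux 19494) — the loci binders are dropped. [folklore] -/
theorem classRecordThree_imcDivTwoLociAtThree_of_imcDivLeaf (h : ClassRecordThree.IMCDivLeafAtThree) :
    ClassRecordThree.IMCDivTwoLociAtThree := by
  unfold ClassRecordThree.IMCDivTwoLociAtThree
  intro W _ _ hX
  exact ⟨fun _ _ ↦ h W hX, fun _ _ ↦ h W hX⟩

/-- **Registered stub (i) `stub_imcDiv3_ram_split` ⟸ the leaf** (signature of the BC3 skeleton of item 19494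
verbatim: H3 on the (ram) ∧ split-multiplicative-at-3 locus). [folklore] -/
theorem classRecordThree_stub_imcDiv3_ram_split_of_imcDivLeaf (h : ClassRecordThree.IMCDivLeafAtThree) :
    ∀ (W : WeierstrassCurve ℚ) [W.IsElliptic] [W.IsGloballyMinimal], ClassX11b W 3 → Ram W 3 →
      W.HasSplitMultiplicativeReductionAtPrime 3 → IMCDivAt₃ W :=
  fun W _ _ hX _ _ ↦ h W hX

/-- **Registered stub (ii) `stub_imcDiv3_unram_surj` ⟸ the leaf** (signature verbatim: H3 on the ¬(ram) ∧ surj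
locus; the SAME stub name and signature is registered on KOLY's item 19506). [folklore] -/
theorem classRecordThree_stub_imcDiv3_unram_surj_of_imcDivLeaf (h : ClassRecordThree.IMCDivLeafAtThree) :
    ∀ (W : WeierstrassCurve ℚ) [W.IsElliptic] [W.IsGloballyMinimal], ClassX11b W 3 → ¬ Ram W 3 →
      Surj W 3 → IMCDivAt₃ W :=
  fun W _ _ hX _ _ ↦ h W hX

/-- **The loci split is lossless**: crux 19494 `IMCDivTwoLociAtThree` ⟺ stub (i) ∧ stub (ii) of its registered BC3
skeleton (signatures verbatim; the skeleton's `IMCDivTwoLociAtThree_of` is the direction ⟸). [folklore] -/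
theorem classRecordThree_imcDivTwoLociAtThree_iff_stubs :
    ClassRecordThree.IMCDivTwoLociAtThree ↔
      (∀ (W : WeierstrassCurve ℚ) [W.IsElliptic] [W.IsGloballyMinimal], ClassX11b W 3 → Ram W 3 →
          W.HasSplitMultiplicativeReductionAtPrime 3 → IMCDivAt₃ W) ∧
        ∀ (W : WeierstrassCurve ℚ) [W.IsElliptic] [W.IsGloballyMinimal], ClassX11b W 3 → ¬ Ram W 3 →
          Surj W 3 → IMCDivAt₃ W := by
  unfold ClassRecordThree.IMCDivTwoLociAtThree
  exact ⟨fun h ↦ ⟨fun W _ _ hX hr hs ↦ (h W hX).1 hr hs, fun W _ _ hX hn hs ↦ (h W hX).2 hn hs⟩,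
    fun h W _ _ hX ↦ ⟨fun hr hs ↦ h.1 W hX hr hs, fun hn hs ↦ h.2 W hX hn hs⟩⟩

/-- **What the leaf adds to the crux, exactly**: `IMCDivLeafAtThree` ⟺ `IMCDivTwoLociAtThree` together with H3 on
road (a)'s atom — a (ram) witness, NON-split multiplicative reduction at 3, surjective image (the population of crux
`SchneiderAtThree`); the ¬surj corner costs nothing because `Three.IMCDivAt₃ W` binds `Surj W 3` inside
(`classRecordThree_imcDivLeafAtThree_iff`). [folklore] -/
theorem classRecordThree_imcDivLeafAtThree_iff_twoLoci_and_roadA :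
    ClassRecordThree.IMCDivLeafAtThree ↔
      ClassRecordThree.IMCDivTwoLociAtThree ∧
        ∀ (W : WeierstrassCurve ℚ) [W.IsElliptic] [W.IsGloballyMinimal], ClassX11b W 3 → Surj W 3 →
          Ram W 3 → ¬ W.HasSplitMultiplicativeReductionAtPrime 3 → IMCDivAt₃ W := by
  constructor
  · intro h
    exact ⟨classRecordThree_imcDivTwoLociAtThree_of_imcDivLeaf h, fun W _ _ hX _ _ _ ↦ h W hX⟩
  · rintro ⟨h, hA⟩
    rw [classRecordThree_imcDivLeafAtThree_iff]
    intro W _ _ hX hsurj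
    obtain ⟨h₁, h₂⟩ := classRecordThree_imcDivTwoLociAtThree_iff_stubs.mp h
    by_cases hram : Ram W 3
    · by_cases hsplit : W.HasSplitMultiplicativeReductionAtPrime 3
      · exact h₁ W hX hram hsplit
      · exact hA W hX hsurj hram hsplit
    · exact h₂ W hX hram hsurj

/-- **Crux 19107 ⟹ crux 19494**: the H3 conjuncts of `HalvesAtThree` are `IMCDivTwoLociAtThree` verbatim. [folklore] -/
theorem classRecordThree_imcDivTwoLociAtThree_of_halvesAtThree (h : ClassRecordThree.HalvesAtThree) :
    ClassRecordThree.IMCDivTwoLociAtThree := by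
  unfold ClassRecordThree.IMCDivTwoLociAtThree
  unfold ClassRecordThree.HalvesAtThree at h
  intro W _ _ hX
  obtain ⟨h₁, h₂⟩ := h W hX
  exact ⟨fun hr hs ↦ (h₁ hr hs).2, fun hn hsu ↦ (h₂ hn hsu).2⟩

/-- **`HalvesAtThree` (crux 19107) ⟸ the H2 child and the two registered H3 stubs, BY NAME**: through the CLOSED
glue 19495 (`halvesAtThreeOfChildren_holds : ValueContinuityAtThree → IMCDivTwoLociAtThree → HalvesAtThree`) and
`classRecordThree_imcDivTwoLociAtThree_iff_stubs`. Every antecedent is open; nothing is discharged.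
[cite: Castella2018, §1 (1.b) and Thm. 4.4 (arXiv:1704.06608 pp. 3, 11) (shape of H3 only; open at p = 3)] -/
theorem classRecordThree_halvesAtThree_of_valueContinuityAtThree_of_imcDivStubs
    (hVC : ClassRecordThree.ValueContinuityAtThree)
    (ha : ∀ (W : WeierstrassCurve ℚ) [W.IsElliptic] [W.IsGloballyMinimal], ClassX11b W 3 → Ram W 3 →
      W.HasSplitMultiplicativeReductionAtPrime 3 → IMCDivAt₃ W)
    (hb : ∀ (W : WeierstrassCurve ℚ) [W.IsElliptic] [W.IsGloballyMinimal], ClassX11b W 3 → ¬ Ram W 3 →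
      Surj W 3 → IMCDivAt₃ W) :
    ClassRecordThree.HalvesAtThree :=
  halvesAtThreeOfChildren_holds hVC (classRecordThree_imcDivTwoLociAtThree_iff_stubs.mpr ⟨ha, hb⟩)

/-! ## §2 The ∃-frame receiving socket for H3 at `p = 3`: `Three.IMCDivAt₃ W` does not see the frame -/

section Socket

variable (W : WeierstrassCurve ℚ)

/-- **H3@3 from ONE divisible frame per datum and embedding.** `Three.IMCDivAt₃ W` demands
`Ch_Λ(X_ac^∅)·R₀⟦T⟧ ⊆ (L)` for EVERY BDP frame `(ι', Ω_K ≠ 0, Ω_p ∈ R₀ˣ, L ∈ R₀⟦T⟧)` over every X11b@3 Heegner datum.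
It suffices that over every such datum and every `ι'` inducing `𝔭` there is SOME frame — any non-zero periods
`Ω_K ∈ ℂ`, `Ω_p ∈ ℂ₃`, and `L ∈ R₀⟦T⟧` with Castella's interpolation property — whose ideal contains the base change of
the characteristic ideal: two frames of the same `(ι', 𝔭, κ, γ, f)` generate the same ideal of `R₀⟦T⟧` (multr1-p1's
`R1.le_span_singleton_iff_of_isBDPLFunction`, at the odd prime `3`, `K` imaginary quadratic, `κ` anticyclotomic —
all binders of the predicate). This is the shape in which a `p = 3` engine (one construction of `L_𝔭^{BDP}(f)` with
its own CM periods and the divisibility for it) would deliver H3; none is in print at `3 ∥ N`.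
[cite: Castella2018, Thm. 3.1 (arXiv:1704.06608 p. 9) and §1 (1.b) (p. 3) (frame and divisibility shapes; nothing asserted at p = 3)]
[cite: CastellaHsieh2018, §3.3, Def. 3.5 and Prop. 3.6 (the interpolation property characterising the frame)] -/
theorem imcDivAt₃_of_exists_frame_dvd
    (h : ∀ (N : ℕ) [NeZero N] (K : Type) [Field K] [NumberField K] (Dt : ModularParametrizationData W N)
      (H : HeegnerDatum N (NumberField.discr K)) (ι : K →+* ℂ) (P : (W.baseChange K).toAffine.Point),
      ClassX11b W 3 → Surj W 3 → W.conductorNorm ℤ = N → IsImaginaryQuadratic K →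
      Odd (NumberField.discr K) → SatisfiesHeegnerHypothesis N K →
      (W.quadraticTwist (NumberField.discr K : ℚ)).entireLFunction 1 ≠ 0 →
      WeierstrassCurve.Affine.Point.map ι.toRatAlgHom P = heegnerPointComplex Dt H →
      ¬ (3 : ℤ) ∣ Dt.c → ¬ IsOfFinAddOrder P →
      ∀ (κ : ZpExtension K 3), κ.IsAnticyclotomic →
        ∀ (γ : Field.absoluteGaloisGroup K) [Fact (κ.IsTopGenerator γ)]
          (𝔭 : HeightOneSpectrum (𝓞 K)), ((3 : ℕ) : 𝓞 K) ∈ 𝔭.asIdeal →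
          𝔭.asIdeal.ramificationIdx (𝓞 ℚ) = 1 → 𝔭.asIdeal.inertiaDeg (𝓞 ℚ) = 1 →
          ∀ (f : CuspForm (CongruenceSubgroup.Gamma0 N) 2), IsNewformOf W f →
            ∀ (ι' : PadicAlgCl 3 ≃+* ℂ), InducesPrime ι' 𝔭 →
              ∃ (ΩK : ℂ) (Ωp : ℂ_[3]) (L : UnrSeries 3), ΩK ≠ 0 ∧ Ωp ≠ 0 ∧
                IsBDPLFunction ι' 𝔭 κ γ f ΩK Ωp L ∧
                  (XAc.charIdeal (W.baseChange K) 3 κ 𝔭 ∅ γ).map (PowerSeries.map (toUnr 3)) ≤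
                    Ideal.span {L}) :
    IMCDivAt₃ W := by
  unfold IMCDivAt₃
  intro N _ K _ _ Dt H ι P hX hsurj hN hK hodd hheeg hL1 hP hc hP0 κ hκ γ hγ 𝔭 h𝔭 he hf f hfW ι' hι'
    ΩK' Ωp' L' hΩK' hL'
  obtain ⟨ΩK, Ωp, L, hΩK, hΩp, hL, hdvd⟩ :=
    h N K Dt H ι P hX hsurj hN hK hodd hheeg hL1 hP hc hP0 κ hκ γ 𝔭 h𝔭 he hf f hfW ι' hι'
  have hΩp' : ((Ωp' : unrIntegers 3) : ℂ_[3]) ≠ 0 := by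
    rw [Ne, ZeroMemClass.coe_eq_zero]
    exact Units.ne_zero Ωp'
  exact (R1.le_span_singleton_iff_of_isBDPLFunction (p := 3) (by decide) hK hκ hγ.out hΩK hΩK' hΩp
    hΩp' hL hL' _).mp hdvd

end Socket

/-- **The H3 leaf (hence cruxes 19494 and 19506) from one divisible frame per datum, class-wide** — the class-level
form of `imcDivAt₃_of_exists_frame_dvd`. CONDITIONAL on its (open) antecedent; nothing discharged.
[cite: Castella2018, §1 (1.b) (arXiv:1704.06608 p. 3) and Thm. 4.4 (p. 11) (shape of H3 only; open at p = 3)] -/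
theorem classRecordThree_imcDivLeafAtThree_of_exists_frame_dvd
    (h : ∀ (W : WeierstrassCurve ℚ) [W.IsElliptic] [W.IsGloballyMinimal],
      ∀ (N : ℕ) [NeZero N] (K : Type) [Field K] [NumberField K] (Dt : ModularParametrizationData W N)
      (H : HeegnerDatum N (NumberField.discr K)) (ι : K →+* ℂ) (P : (W.baseChange K).toAffine.Point),
      ClassX11b W 3 → Surj W 3 → W.conductorNorm ℤ = N → IsImaginaryQuadratic K →
      Odd (NumberField.discr K) → SatisfiesHeegnerHypothesis N K →
      (W.quadraticTwist (NumberField.discr K : ℚ)).entireLFunction 1 ≠ 0 →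
      WeierstrassCurve.Affine.Point.map ι.toRatAlgHom P = heegnerPointComplex Dt H →
      ¬ (3 : ℤ) ∣ Dt.c → ¬ IsOfFinAddOrder P →
      ∀ (κ : ZpExtension K 3), κ.IsAnticyclotomic →
        ∀ (γ : Field.absoluteGaloisGroup K) [Fact (κ.IsTopGenerator γ)]
          (𝔭 : HeightOneSpectrum (𝓞 K)), ((3 : ℕ) : 𝓞 K) ∈ 𝔭.asIdeal →
          𝔭.asIdeal.ramificationIdx (𝓞 ℚ) = 1 → 𝔭.asIdeal.inertiaDeg (𝓞 ℚ) = 1 →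
          ∀ (f : CuspForm (CongruenceSubgroup.Gamma0 N) 2), IsNewformOf W f →
            ∀ (ι' : PadicAlgCl 3 ≃+* ℂ), InducesPrime ι' 𝔭 →
              ∃ (ΩK : ℂ) (Ωp : ℂ_[3]) (L : UnrSeries 3), ΩK ≠ 0 ∧ Ωp ≠ 0 ∧
                IsBDPLFunction ι' 𝔭 κ γ f ΩK Ωp L ∧
                  (XAc.charIdeal (W.baseChange K) 3 κ 𝔭 ∅ γ).map (PowerSeries.map (toUnr 3)) ≤
                    Ideal.span {L}) :
    ClassRecordThree.IMCDivLeafAtThree :=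
  fun W _ _ _ ↦ imcDivAt₃_of_exists_frame_dvd W (h W)

/-! ## §3 Route `KolyvaginRoadThree`: crux 19506 against crux 19494, its registered stubs and the leaf -/

/-- **K2@3's H3 crux implies KOLY's**: `ClassRecordThree.IMCDivTwoLociAtThree` (19494) ⟹
`KolyvaginRoadThree.IMCDivTwoLociTamAtThree` (19506) — the Kolyvagin road only restricts locus (i) by the extra binder
`3 ∣ ∏ c_ℓ`; locus (ii) is identical. [folklore] -/
theorem kolyvaginRoadThree_imcDivTwoLociTamAtThree_of_classRecordThree
    (h : ClassRecordThree.IMCDivTwoLociAtThree) : KolyvaginRoadThree.IMCDivTwoLociTamAtThree := by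
  unfold KolyvaginRoadThree.IMCDivTwoLociTamAtThree
  intro W _ _ hX
  obtain ⟨h₁, h₂⟩ := classRecordThree_imcDivTwoLociAtThree_iff_stubs.mp h
  exact ⟨fun hr hs _ ↦ h₁ W hX hr hs, fun hn hsu ↦ h₂ W hX hn hsu⟩

/-- **The loci split of crux 19506 is lossless**: `IMCDivTwoLociTamAtThree` ⟺ stub (i) `stub_imcDiv3_ram_split_tam`
∧ stub (ii) `stub_imcDiv3_unram_surj` of its registered BC3 skeleton (signatures verbatim). [folklore] -/
theorem kolyvaginRoadThree_imcDivTwoLociTamAtThree_iff_stubs :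
    KolyvaginRoadThree.IMCDivTwoLociTamAtThree ↔
      (∀ (W : WeierstrassCurve ℚ) [W.IsElliptic] [W.IsGloballyMinimal], ClassX11b W 3 → Ram W 3 →
          W.HasSplitMultiplicativeReductionAtPrime 3 → 3 ∣ W.tamagawaProduct → IMCDivAt₃ W) ∧
        ∀ (W : WeierstrassCurve ℚ) [W.IsElliptic] [W.IsGloballyMinimal], ClassX11b W 3 → ¬ Ram W 3 →
          Surj W 3 → IMCDivAt₃ W := by
  unfold KolyvaginRoadThree.IMCDivTwoLociTamAtThree
  exact ⟨fun h ↦ ⟨fun W _ _ hX hr hs ht ↦ (h W hX).1 hr hs ht, fun W _ _ hX hn hs ↦ (h W hX).2 hn hs⟩,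
    fun h W _ _ hX ↦ ⟨fun hr hs ht ↦ h.1 W hX hr hs ht, fun hn hs ↦ h.2 W hX hn hs⟩⟩

/-- **K2@3's stub (i) implies KOLY's stub (i)**: `stub_imcDiv3_ram_split` ⟹ `stub_imcDiv3_ram_split_tam` (the
Tamagawa binder is dropped); stub (ii) `stub_imcDiv3_unram_surj` is registered with the SAME name and signature on
both items 19494 and 19506, so one proof of it serves both routes. [folklore] -/
theorem kolyvaginRoadThree_stub_imcDiv3_ram_split_tam_of_stub_imcDiv3_ram_split
    (ha : ∀ (W : WeierstrassCurve ℚ) [W.IsElliptic] [W.IsGloballyMinimal], ClassX11b W 3 → Ram W 3 →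
      W.HasSplitMultiplicativeReductionAtPrime 3 → IMCDivAt₃ W) :
    ∀ (W : WeierstrassCurve ℚ) [W.IsElliptic] [W.IsGloballyMinimal], ClassX11b W 3 → Ram W 3 →
      W.HasSplitMultiplicativeReductionAtPrime 3 → 3 ∣ W.tamagawaProduct → IMCDivAt₃ W :=
  fun W _ _ hX hr hs _ ↦ ha W hX hr hs

/-- **The KOLY leaf ⟹ crux 19506** (`KolyvaginRoadThree.IMCDivLeafAtThree` is `ClassRecordThree.IMCDivLeafAtThree`
verbatim, `kolyvaginRoadThree_imcDivLeafAtThree_iff_classRecordThree`). [folklore] -/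
theorem kolyvaginRoadThree_imcDivTwoLociTamAtThree_of_imcDivLeaf (h : KolyvaginRoadThree.IMCDivLeafAtThree) :
    KolyvaginRoadThree.IMCDivTwoLociTamAtThree :=
  kolyvaginRoadThree_imcDivTwoLociTamAtThree_of_classRecordThree
    (classRecordThree_imcDivTwoLociAtThree_of_imcDivLeaf
      (kolyvaginRoadThree_imcDivLeafAtThree_iff_classRecordThree.mp h))

/-- **`HalvesTamAtThree` (crux 19155) ⟸ the H2 child and the two registered KOLY H3 stubs, BY NAME**: through the
CLOSED glue 19507 (`halvesTamAtThreeOfChildren_holds`) and `kolyvaginRoadThree_imcDivTwoLociTamAtThree_iff_stubs`.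
Every antecedent is open; nothing is discharged.
[cite: Castella2018, §1 (1.b) and Thm. 4.4 (arXiv:1704.06608 pp. 3, 11) (shape of H3 only; open at p = 3)] -/
theorem kolyvaginRoadThree_halvesTamAtThree_of_valueContinuityAtThree_of_imcDivStubs
    (hVC : KolyvaginRoadThree.ValueContinuityAtThree)
    (ha : ∀ (W : WeierstrassCurve ℚ) [W.IsElliptic] [W.IsGloballyMinimal], ClassX11b W 3 → Ram W 3 →
      W.HasSplitMultiplicativeReductionAtPrime 3 → 3 ∣ W.tamagawaProduct → IMCDivAt₃ W)
    (hb : ∀ (W : WeierstrassCurve ℚ) [W.IsElliptic] [W.IsGloballyMinimal], ClassX11b W 3 → ¬ Ram W 3 →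
      Surj W 3 → IMCDivAt₃ W) :
    KolyvaginRoadThree.HalvesTamAtThree :=
  halvesTamAtThreeOfChildren_holds hVC (kolyvaginRoadThree_imcDivTwoLociTamAtThree_iff_stubs.mpr ⟨ha, hb⟩)

/-- **What crux 19494 adds to crux 19506, exactly**: `ClassRecordThree.IMCDivTwoLociAtThree` ⟺
`KolyvaginRoadThree.IMCDivTwoLociTamAtThree` ∧ H3 on the sub-locus (ram) ∧ split(3) ∧ `¬ 3 ∣ ∏ c_ℓ` (the
Tamagawa-unit part of locus (i), which the Kolyvagin road books elsewhere). [folklore] -/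
theorem classRecordThree_imcDivTwoLociAtThree_iff_koly_and_tamagawaUnit :
    ClassRecordThree.IMCDivTwoLociAtThree ↔
      KolyvaginRoadThree.IMCDivTwoLociTamAtThree ∧
        ∀ (W : WeierstrassCurve ℚ) [W.IsElliptic] [W.IsGloballyMinimal], ClassX11b W 3 → Ram W 3 →
          W.HasSplitMultiplicativeReductionAtPrime 3 → ¬ 3 ∣ W.tamagawaProduct → IMCDivAt₃ W := by
  constructor
  · intro h
    refine ⟨kolyvaginRoadThree_imcDivTwoLociTamAtThree_of_classRecordThree h, fun W _ _ hX hr hs _ ↦ ?_⟩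
    exact (classRecordThree_imcDivTwoLociAtThree_iff_stubs.mp h).1 W hX hr hs
  · rintro ⟨h, hU⟩
    obtain ⟨h₁, h₂⟩ := kolyvaginRoadThree_imcDivTwoLociTamAtThree_iff_stubs.mp h
    refine classRecordThree_imcDivTwoLociAtThree_iff_stubs.mpr ⟨fun W _ _ hX hr hs ↦ ?_, h₂⟩
    by_cases ht : 3 ∣ W.tamagawaProduct
    · exact h₁ W hX hr hs ht
    · exact hU W hX hr hs ht

end Summit.BirchSwinnertonDyer.BirchSwinnertonDyer.Theorems

end
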